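import Mathlib
import Summits.Ventures.PercRepro.TriangleCapThreeTrianglesG

/-!
# PercRepro — THE CELL `(8, 13)`, PART B: THE DEFICIT OF THE SIX PAIRS OF A TRIANGLE, AND THE PAIR SETS OF A
FAMILY OF TRIANGLES (p3, gen 37; part 74)

* **`sum_deficit_pairs_triangle`** — the six ordered pairs of a triangle `u v w` carry deficit at least
  `2 (k − 3) + 4 |outer|` (the pair `(u, v)` is far from the outer vertices and from `priv w`; the private
  neighbourhoods and the outer vertices partition the rest, `card_partition_triangle`);
* **`pairs_disjoint_of_ne`** — the ordered pair sets of two distinct triangles of a `K₄⁻`-free graph are disjoint;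
* **`card_pairs_triangle`** — a triangle carries six ordered pairs.
Axioms: standard.
-/

namespace PercRepro

namespace TriangleCap

namespace C047

open Finset

variable {V : Type*} [Fintype V] [DecidableEq V]

omit [Fintype V] in
/-- The ordered adjacent pairs inside a triangle `{u, v, w}` are its six ordered pairs. -/
theorem pairs_triangle_eq (D : SimpleGraph V) [DecidableRel D.Adj] {u v w : V} (huv : D.Adj u v) (huw : D.Adj u w)
    (hvw : D.Adj v w) :
    (({u, v, w} : Finset V) ×ˢ ({u, v, w} : Finset V)).filter (fun p : V × V => D.Adj p.1 p.2) =
      {(u, v), (v, u), (u, w), (w, u), (v, w), (w, v)} := by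
  ext ⟨p, q⟩
  simp only [mem_filter, mem_product, mem_insert, mem_singleton, Prod.mk.injEq]
  constructor
  · rintro ⟨⟨hp, hq⟩, hpq⟩
    rcases hp with rfl | rfl | rfl <;> rcases hq with rfl | rfl | rfl
    all_goals first
      | exact absurd hpq (SimpleGraph.irrefl D)
      | tauto
  · rintro (⟨rfl, rfl⟩ | ⟨rfl, rfl⟩ | ⟨rfl, rfl⟩ | ⟨rfl, rfl⟩ | ⟨rfl, rfl⟩ | ⟨rfl, rfl⟩)
    all_goals first
      | exact ⟨⟨by tauto, by tauto⟩, huv⟩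
      | exact ⟨⟨by tauto, by tauto⟩, huv.symm⟩
      | exact ⟨⟨by tauto, by tauto⟩, huw⟩
      | exact ⟨⟨by tauto, by tauto⟩, huw.symm⟩
      | exact ⟨⟨by tauto, by tauto⟩, hvw⟩
      | exact ⟨⟨by tauto, by tauto⟩, hvw.symm⟩

omit [Fintype V] in
/-- A triangle carries six ordered pairs. -/
theorem card_pairs_triangle (D : SimpleGraph V) [DecidableRel D.Adj] {u v w : V} (huv : D.Adj u v) (huw : D.Adj u w)
    (hvw : D.Adj v w) :
    ((({u, v, w} : Finset V) ×ˢ ({u, v, w} : Finset V)).filter (fun p : V × V => D.Adj p.1 p.2)).card = 6 := by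
  rw [pairs_triangle_eq D huv huw hvw]
  have h1 := huv.ne
  have h2 := huw.ne
  have h3 := hvw.ne
  rw [card_insert_of_notMem, card_insert_of_notMem, card_insert_of_notMem, card_insert_of_notMem,
    card_insert_of_notMem, card_singleton]
  all_goals simp [h1, h2, h3, h1.symm, h2.symm, h3.symm]

/-- The pair `(u, v)` of a triangle `u v w` is far from the outer vertices and from the private neighbours of `w`. -/
theorem deficit_pair_ge (D : SimpleGraph V) [DecidableRel D.Adj] (u v w : V) :
    (outer D u v w).card + (priv D w u v).card ≤ deficit D (u, v) := by
  have hsub : outer D u v w ∪ priv D w u v ⊆ univ.filter (fun t => ¬ D.Adj u t ∧ ¬ D.Adj v t) := by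
    intro t ht
    rw [mem_union, mem_outer, mem_priv] at ht
    rw [mem_filter]
    rcases ht with h | h
    · exact ⟨mem_univ _, h.1, h.2.1⟩
    · exact ⟨mem_univ _, h.2.1, h.2.2⟩
  have hdisj : Disjoint (outer D u v w) (priv D w u v) := by
    rw [disjoint_left]
    intro t h1 h2
    rw [mem_outer] at h1
    rw [mem_priv] at h2
    exact h1.2.2 h2.1
  have := card_le_card hsub
  rw [card_union_of_disjoint hdisj] at this
  exact this

/-- **THE SIX PAIRS OF A TRIANGLE PAY `2 (k − 3) + 4 |outer|`.** -/
theorem sum_deficit_pairs_triangle (D : SimpleGraph V) [DecidableRel D.Adj] (hK : K4mFree D) {u v w : V}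
    (huv : D.Adj u v) (huw : D.Adj u w) (hvw : D.Adj v w) :
    2 * (Fintype.card V - 3) + 4 * (outer D u v w).card ≤
      ∑ p ∈ (({u, v, w} : Finset V) ×ˢ ({u, v, w} : Finset V)).filter (fun p : V × V => D.Adj p.1 p.2),
        deficit D p := by
  rw [pairs_triangle_eq D huv huw hvw]
  have h1 := huv.ne
  have h2 := huw.ne
  have h3 := hvw.ne
  rw [sum_insert, sum_insert, sum_insert, sum_insert, sum_insert, sum_singleton]
  all_goals try simp [h1, h2, h3, h1.symm, h2.symm, h3.symm]
  have hpart := card_partition_triangle D hK huv huw hvw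
  have e1 := deficit_pair_ge D u v w
  have e2 := deficit_pair_ge D u w v
  have e3 := deficit_pair_ge D v w u
  rw [deficit_swap D v u, deficit_swap D w u, deficit_swap D w v]
  have o1 : outer D u w v = outer D u v w := by
    unfold outer; apply filter_congr; intro t _; tauto
  have o2 : outer D v w u = outer D u v w := by
    unfold outer; apply filter_congr; intro t _; tauto
  rw [o1] at e2
  rw [o2] at e3
  omega

/-- The pair sets of two distinct triangles of a `K₄⁻`-free graph are disjoint. -/
theorem pairs_disjoint_of_ne (D : SimpleGraph V) [DecidableRel D.Adj] (hK : K4mFree D) {u v w u' v' w' : V}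
    (huv : D.Adj u v) (huw : D.Adj u w) (hvw : D.Adj v w) (huv' : D.Adj u' v') (huw' : D.Adj u' w')
    (hvw' : D.Adj v' w') (hne : ({u, v, w} : Finset V) ≠ {u', v', w'}) :
    Disjoint ((({u, v, w} : Finset V) ×ˢ ({u, v, w} : Finset V)).filter (fun p : V × V => D.Adj p.1 p.2))
      ((({u', v', w'} : Finset V) ×ˢ ({u', v', w'} : Finset V)).filter (fun p : V × V => D.Adj p.1 p.2)) := by
  rw [disjoint_left]
  intro p hp hp'
  rw [mem_filter, mem_product] at hp hp'
  obtain ⟨⟨hp1, hp2⟩, hpq⟩ := hp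
  obtain ⟨⟨hp1', hp2'⟩, -⟩ := hp'
  -- the third vertices of the two triangles are both common neighbours of `p.1, p.2`
  have h3 : ({u, v, w} : Finset V).card = 3 := card_triple huv.ne huw.ne hvw.ne
  have h3' : ({u', v', w'} : Finset V).card = 3 := card_triple huv'.ne huw'.ne hvw'.ne
  obtain ⟨r, hr, hr1, hr2⟩ := exists_third_of_clique D h3 (clique_triple D huv huw hvw) hp1 hp2 hpq.ne
  obtain ⟨r', hr', hr1', hr2'⟩ := exists_third_of_clique D h3' (clique_triple D huv' huw' hvw') hp1' hp2' hpq.ne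
  have hrr := eq_of_common_nbr D hK hpq hr1 hr2 hr1' hr2'
  subst hrr
  -- so both triangles are `{p.1, p.2, r}`
  have hsub : ({p.1, p.2, r} : Finset V) ⊆ {u, v, w} := by
    intro t ht
    simp only [mem_insert, mem_singleton] at ht
    rcases ht with rfl | rfl | rfl
    · exact hp1
    · exact hp2
    · exact hr
  have hsub' : ({p.1, p.2, r} : Finset V) ⊆ {u', v', w'} := by
    intro t ht
    simp only [mem_insert, mem_singleton] at ht
    rcases ht with rfl | rfl | rfl
    · exact hp1'
    · exact hp2'
    · exact hr'
  have hc : ({p.1, p.2, r} : Finset V).card = 3 := card_triple hpq.ne hr1.ne hr2.ne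
  have e1 : ({p.1, p.2, r} : Finset V) = {u, v, w} := eq_of_subset_of_card_le hsub (by omega)
  have e2 : ({p.1, p.2, r} : Finset V) = {u', v', w'} := eq_of_subset_of_card_le hsub' (by omega)
  exact hne (e1.symm.trans e2)

end C047

end TriangleCap

end PercRepro
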